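import Summits.PneNP.PneNP.Theorems.ConvexRankGatesCliqueExtLowerBoundShortMaxtermsCore
import Summits.PneNP.PneNP.Theorems.ConvexRankGatesCliqueExtLowerBoundHorns
import Summits.PneNP.PneNP.Theorems.ConvexRankGatesCliqueExtLowerBoundStubNarrowAlgebraicHelpers

/-!
# Bounded-size rejection certificates are idle (`rej_shortCertified_le`, `rej_blocking_le`)
(crux `ConvexRankGates.CliqueExtLowerBound`, stmt-PneNP-10682; line `width-threshold-certificate-sparsity`,
lead c12 — the USE of the registered vertex-core dichotomy `ShortMaxtermsCore.shortMaxterms_core`, p154713)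

On the referee pair of the line (positives = clique vectors of the `k`-sets, negatives = "every edge on except
those of a `(#E/⌊m^{1/8}⌋₊)`-subset `M`"), a family `𝓛` of nonempty edge sets of `≤ w` edges each that is met by
more than `(2w)^q · C(m-q, k-q)` of the clique vectors has, by the core dichotomy, a vertex core `W` of size
`≤ 4w²q` containing an edge of every member; a negative on which some member is entirely OFF therefore has an
edge inside `W` off, which happens for at most `C(4w²q + 1, 2) / ⌊m^{1/8}⌋₊` of the negatives
(`Horns.card_filter_not_satTerm_mul_div_le`). For a monotone-style gate `g` whose rejections are CERTIFIED by
`𝓛` (every member is a blocking set: all its edges off forces rejection), accepted cliques meet every member, so: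
if `g` accepts more than `(2w)^q · C(m-q, k-q)` bare cliques, the negatives rejected through a certificate in `𝓛`
are at most `C(4w²q+1, 2)/⌊m^{1/8}⌋₊` of all negatives (`rej_blocking_le`) — within the horn slack
`(r-1)/⌊m^{1/8}⌋₊` of `Horns.horns_of_pair` once `r` is large, i.e. IDLE. Together with the landed dual engine
`ShortCnf.sandwichable_of_shortCNF` (p154412) and `SandwichEffectiveWidth.sandwichable_of_shortDNF`: a counterexample
to any leaf of the line needs long certificates on BOTH sides.
-/

set_option linter.dupNamespace false

open Literature.Computability.Complexity Filter Finset

namespace Summit.PneNP.PneNP.Theorems.CliqueExtLowerBound.WidthThreshold.ShortMaxtermsIdle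

open Summit.PneNP.PneNP.Theorems.CliqueExtLowerBound.WidthThreshold.NarrowAlgebraicHelpers

variable {m : ℕ}

open Classical in
/-- The edge slots with both endpoints in `W` number at most `C(#W + 1, 2)`. [folklore] -/
theorem card_filter_inside_le (W : Finset (Fin m)) :
    #((univ : Finset ((⊤ : SimpleGraph (Fin m)).edgeSet)).filter
        fun e : ((⊤ : SimpleGraph (Fin m)).edgeSet) => ∀ v ∈ (e : Sym2 (Fin m)), v ∈ W) ≤ (#W + 1).choose 2 := by
  set R₀ := (univ : Finset ((⊤ : SimpleGraph (Fin m)).edgeSet)).filter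
    fun e : ((⊤ : SimpleGraph (Fin m)).edgeSet) => ∀ v ∈ (e : Sym2 (Fin m)), v ∈ W with hR₀
  have hinj : #(R₀.image Subtype.val) = #R₀ := card_image_of_injective _ Subtype.val_injective
  have hsub : edgeVerts (R₀.image Subtype.val) ⊆ W := by
    refine edgeVerts_subset fun e he v hv => ?_
    obtain ⟨e', he', rfl⟩ := mem_image.1 he
    exact (mem_filter.1 he').2 v hv
  calc #R₀ = #(R₀.image Subtype.val) := hinj.symm
    _ ≤ (#(edgeVerts (R₀.image Subtype.val)) + 1).choose 2 := card_le_choose_card_edgeVerts _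
    _ ≤ (#W + 1).choose 2 := Nat.choose_le_choose 2 (Nat.succ_le_succ (card_le_card hsub))

open Classical in
/-- **Short certificates are idle (family form).** If a family `𝓛` of nonempty edge sets with `≤ w` edges each
is met (in an on-edge) by more than `(2w)^q · C(m-q, k-q)` of the clique vectors of the `k`-sets, then the
negatives of the referee pair on which some member of `𝓛` is entirely off are at most
`C(4w²q + 1, 2) / ⌊m^{1/8}⌋₊` of all negatives (cross-multiplied). [folklore] -/
theorem rej_shortCertified_le (m k w q : ℕ) (𝓛 : Finset (Finset ((⊤ : SimpleGraph (Fin m)).edgeSet)))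
    (h𝓛 : ∀ L ∈ 𝓛, L.Nonempty ∧ #L ≤ w)
    (hacc : (2 * w) ^ q * (m - q).choose (k - q) <
      #((posGraphs m k).filter fun x => ∀ L ∈ 𝓛, ∃ e ∈ L, x e = true)) :
    #((((powersetCard (Fintype.card ((⊤ : SimpleGraph (Fin m)).edgeSet) / ⌊(m : ℝ) ^ (1 / 8 : ℝ)⌋₊)
        (univ : Finset ((⊤ : SimpleGraph (Fin m)).edgeSet))).image (fun M => fun e => decide (e ∉ M)))).filter
        fun x => ∃ L ∈ 𝓛, ∀ e ∈ L, x e = false) * ⌊(m : ℝ) ^ (1 / 8 : ℝ)⌋₊ ≤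
      (4 * w ^ 2 * q + 1).choose 2 *
        #(((powersetCard (Fintype.card ((⊤ : SimpleGraph (Fin m)).edgeSet) / ⌊(m : ℝ) ^ (1 / 8 : ℝ)⌋₊)
          (univ : Finset ((⊤ : SimpleGraph (Fin m)).edgeSet))).image (fun M => fun e => decide (e ∉ M)))) := by
  set N := ((powersetCard (Fintype.card ((⊤ : SimpleGraph (Fin m)).edgeSet) / ⌊(m : ℝ) ^ (1 / 8 : ℝ)⌋₊)
    (univ : Finset ((⊤ : SimpleGraph (Fin m)).edgeSet))).image (fun M => fun e => decide (e ∉ M))) with hN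
  -- the vertex core
  rcases ShortMaxtermsCore.shortMaxterms_core m k w q 𝓛 h𝓛 with ⟨W, hWcard, hW⟩ | hfew
  · set R₀ := (univ : Finset ((⊤ : SimpleGraph (Fin m)).edgeSet)).filter
      fun e : ((⊤ : SimpleGraph (Fin m)).edgeSet) => ∀ v ∈ (e : Sym2 (Fin m)), v ∈ W with hR₀
    -- a negative with a member entirely off has an edge inside the core off
    have hsub : (N.filter fun x => ∃ L ∈ 𝓛, ∀ e ∈ L, x e = false) ⊆ N.filter fun x => ¬ SatTerm R₀ x := by
      intro x hx
      rw [mem_filter] at hx ⊢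
      obtain ⟨hxN, L, hL, hoff⟩ := hx
      obtain ⟨e, heL, heW⟩ := hW L hL
      refine ⟨hxN, fun hsat => ?_⟩
      have h1 : x e = true := hsat e (mem_filter.2 ⟨mem_univ _, heW⟩)
      rw [hoff e heL] at h1
      exact Bool.false_ne_true h1
    have h1 := Nat.mul_le_mul_right ⌊(m : ℝ) ^ (1 / 8 : ℝ)⌋₊ (card_le_card hsub)
    have h2 := Horns.card_filter_not_satTerm_mul_div_le R₀ ⌊(m : ℝ) ^ (1 / 8 : ℝ)⌋₊
    have h3 : #R₀ ≤ (4 * w ^ 2 * q + 1).choose 2 :=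
      (card_filter_inside_le W).trans (Nat.choose_le_choose 2 (Nat.succ_le_succ hWcard))
    exact h1.trans (h2.trans (Nat.mul_le_mul_right _ h3))
  · exact absurd hfew (not_le.2 hacc)

open Classical in
/-- **Short certificates are idle (gate form).** Let `g` be any Boolean function of the edge slots and `𝓛` a family
of BLOCKING SETS of `g` (nonempty, `≤ w` edges each: all edges of a member off forces `g = false` — e.g. maxterms
of a monotone `g`). If `g` accepts more than `(2w)^q · C(m-q, k-q)` clique vectors of the `k`-sets, then the
negatives of the referee pair rejected THROUGH a certificate in `𝓛` (some member entirely off) are at most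
`C(4w²q + 1, 2) / ⌊m^{1/8}⌋₊` of all negatives. With `q = 2(c+2)` the acceptance hypothesis is implied, for large
`m`, by acceptance of more than `#P/(8m^{c+1})` positives, and the bound sits inside the horn slack
`(r-1)/⌊m^{1/8}⌋₊` of `Horns.horns_of_pair` for `r ≥ C(4w²q+1,2) + 2`: rejection certified by maxterms of
bounded size cannot make a gate a counterexample to a leaf. [folklore] -/
theorem rej_blocking_le (m k w q : ℕ) (g : (((⊤ : SimpleGraph (Fin m)).edgeSet) → Bool) → Bool)
    (𝓛 : Finset (Finset ((⊤ : SimpleGraph (Fin m)).edgeSet))) (h𝓛 : ∀ L ∈ 𝓛, L.Nonempty ∧ #L ≤ w)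
    (hblock : ∀ L ∈ 𝓛, ∀ y : ((⊤ : SimpleGraph (Fin m)).edgeSet) → Bool, (∀ e ∈ L, y e = false) → g y = false)
    (hacc : (2 * w) ^ q * (m - q).choose (k - q) < #((posGraphs m k).filter fun x => g x = true)) :
    #((((powersetCard (Fintype.card ((⊤ : SimpleGraph (Fin m)).edgeSet) / ⌊(m : ℝ) ^ (1 / 8 : ℝ)⌋₊)
        (univ : Finset ((⊤ : SimpleGraph (Fin m)).edgeSet))).image (fun M => fun e => decide (e ∉ M)))).filter
        fun x => g x = false ∧ ∃ L ∈ 𝓛, ∀ e ∈ L, x e = false) * ⌊(m : ℝ) ^ (1 / 8 : ℝ)⌋₊ ≤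
      (4 * w ^ 2 * q + 1).choose 2 *
        #(((powersetCard (Fintype.card ((⊤ : SimpleGraph (Fin m)).edgeSet) / ⌊(m : ℝ) ^ (1 / 8 : ℝ)⌋₊)
          (univ : Finset ((⊤ : SimpleGraph (Fin m)).edgeSet))).image (fun M => fun e => decide (e ∉ M)))) := by
  -- accepted cliques meet every blocking set
  have hmeet : ((posGraphs m k).filter fun x => g x = true) ⊆
      (posGraphs m k).filter fun x => ∀ L ∈ 𝓛, ∃ e ∈ L, x e = true := by
    intro x hx
    rw [mem_filter] at hx ⊢
    refine ⟨hx.1, fun L hL => ?_⟩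
    by_contra hne
    push Not at hne
    have hoff : ∀ e ∈ L, x e = false := fun e he => by
      have := hne e he
      cases hxe : x e
      · rfl
      · exact absurd hxe this
    have := hblock L hL x hoff
    rw [hx.2] at this
    exact Bool.noConfusion this
  have hacc' : (2 * w) ^ q * (m - q).choose (k - q) <
      #((posGraphs m k).filter fun x => ∀ L ∈ 𝓛, ∃ e ∈ L, x e = true) :=
    lt_of_lt_of_le hacc (card_le_card hmeet)
  refine le_trans (Nat.mul_le_mul_right _ (card_le_card fun x hx => ?_))
    (rej_shortCertified_le m k w q 𝓛 h𝓛 hacc')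
  rw [mem_filter] at hx ⊢
  exact ⟨hx.1, hx.2.2⟩

open Classical in
/-- **Short certificates are idle (leaf form, asymptotic).** For every `c` and `w`, for all large `m`, on the
referee pair at `k = ⌈m^{1/4}⌉₊`: if a Boolean function `g` of the edge slots accepts MORE than `#P/(8m^{c+1})` of
the bare `k`-cliques (the positive horn of `Horns.horns_of_pair` fails), then for every family `𝓛` of blocking sets
of `g` with `≤ w` edges each, the negatives rejected through a member of `𝓛` are at most
`C(16 w² (c+3) + 1, 2) / ⌊m^{1/8}⌋₊` of all negatives — a constant (in `m`) multiple of `1/⌊m^{1/8}⌋₊`, inside the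
horn slack `(r-1)/⌊m^{1/8}⌋₊` for `r ≥ C(16w²(c+3)+1, 2) + 2`. So a counterexample to a leaf at level `c` must owe
all but `O_{c,w}(1)/⌊m^{1/8}⌋₊` of its rejections to minimal rejection certificates of MORE than `w` edges, for
every constant `w`. (`q = 4(c+3)` in `rej_blocking_le`; numerics `pos_numerics`, `choose_sub_mul_pow_le`.) [folklore] -/
theorem eventually_rej_blocking_le : ∀ c w : ℕ, ∀ᶠ m : ℕ in atTop,
    ∀ (g : (((⊤ : SimpleGraph (Fin m)).edgeSet) → Bool) → Bool)
      (𝓛 : Finset (Finset ((⊤ : SimpleGraph (Fin m)).edgeSet))),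
      (∀ L ∈ 𝓛, L.Nonempty ∧ #L ≤ w) →
      (∀ L ∈ 𝓛, ∀ y : ((⊤ : SimpleGraph (Fin m)).edgeSet) → Bool, (∀ e ∈ L, y e = false) → g y = false) →
      #(posGraphs m ⌈(m : ℝ) ^ (1 / 4 : ℝ)⌉₊) <
        #((posGraphs m ⌈(m : ℝ) ^ (1 / 4 : ℝ)⌉₊).filter fun x => g x = true) * (8 * m ^ (c + 1)) →
      #((((powersetCard (Fintype.card ((⊤ : SimpleGraph (Fin m)).edgeSet) / ⌊(m : ℝ) ^ (1 / 8 : ℝ)⌋₊)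
          (univ : Finset ((⊤ : SimpleGraph (Fin m)).edgeSet))).image (fun M => fun e => decide (e ∉ M)))).filter
          fun x => g x = false ∧ ∃ L ∈ 𝓛, ∀ e ∈ L, x e = false) * ⌊(m : ℝ) ^ (1 / 8 : ℝ)⌋₊ ≤
        (4 * w ^ 2 * (4 * (c + 3)) + 1).choose 2 *
          #(((powersetCard (Fintype.card ((⊤ : SimpleGraph (Fin m)).edgeSet) / ⌊(m : ℝ) ^ (1 / 8 : ℝ)⌋₊)
            (univ : Finset ((⊤ : SimpleGraph (Fin m)).edgeSet))).image (fun M => fun e => decide (e ∉ M)))) := by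
  intro c w
  set q := 4 * (c + 3) with hq
  filter_upwards [eventually_ge_atTop 17, eventually_ge_atTop (8 * (2 * w + 1 - 1) ^ q),
    eventually_ge_atTop (q ^ 4)] with m hm17 hm8 hmq
  intro g 𝓛 h𝓛 hblock hacc
  -- the parameters
  have hm1 : 1 ≤ m := by omega
  have hkm : m ≤ ⌈(m : ℝ) ^ (1 / 4 : ℝ)⌉₊ ^ 4 := le_ceil_rpow_pow m 4 (by norm_num)
  have hk1m : (⌈(m : ℝ) ^ (1 / 4 : ℝ)⌉₊ - 1) ^ 4 < m := ceil_rpow_sub_one_pow_lt hm1 4 (by norm_num)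
  set k := ⌈(m : ℝ) ^ (1 / 4 : ℝ)⌉₊ with hk
  obtain ⟨hk2, hQ1, hpos⟩ := pos_numerics (c := c) (r := q) (s := 2 * w + 1) hm17 hm8 hkm hk1m
  have h2w : 2 * w + 1 - 1 = 2 * w := by omega
  rw [h2w] at hpos
  -- `q ≤ k`
  have hqk : q ≤ k := by
    by_contra hlt
    push Not at hlt
    have h1 : k ^ 4 ≤ (q - 1) ^ 4 := Nat.pow_le_pow_left (by omega) 4
    have h2 : (q - 1) ^ 4 < q ^ 4 := Nat.pow_lt_pow_left (by omega) (by norm_num)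
    omega
  -- the acceptance count exceeds the threshold of the core dichotomy
  have hchoose : (m - q).choose (k - q) * (m / k) ^ q ≤ m.choose k :=
    choose_sub_mul_pow_le hQ1 hqk (Nat.mul_div_le m k)
  have hP : #(posGraphs m k) = m.choose k := card_posGraphs hk2
  have hthr : (2 * w) ^ q * (m - q).choose (k - q) <
      #((posGraphs m k).filter fun x => g x = true) := by
    refine Nat.lt_of_mul_lt_mul_right (a := 8 * m ^ (c + 1)) ?_
    calc (2 * w) ^ q * (m - q).choose (k - q) * (8 * m ^ (c + 1))
        = (m - q).choose (k - q) * (8 * m ^ (c + 1) * (2 * w) ^ q) := by ring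
      _ ≤ (m - q).choose (k - q) * (m / k) ^ q := Nat.mul_le_mul_left _ hpos
      _ ≤ m.choose k := hchoose
      _ = #(posGraphs m k) := hP.symm
      _ < _ := hacc
  exact rej_blocking_le m k w q g 𝓛 h𝓛 hblock hthr

end Summit.PneNP.PneNP.Theorems.CliqueExtLowerBound.WidthThreshold.ShortMaxtermsIdle
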